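import Summits.BirchSwinnertonDyer.BirchSwinnertonDyer.Theorems.ManinLocalTwoThreeNeronFLineBookkeeping
import Mathlib.LinearAlgebra.Quotient.Card
import HarnessLib

/-!
# The `f`-line index is monotone in the lattice: `r^𝒩 ∣ r_AL ∣ r_f`, and imc's sandwich `r^𝒩_p ≤ v_p(deg φ) ≤ e_f`

Cell bsd-f2-manin, prover seat p3 g17 (typer g21 pointer (b), imc MEMO-imc §37 ENGINE H «PROVED sandwich r^𝒩 ≤ v₂(deg φ) ≤ e_f»).
* `lineIndex_dvd_of_le`: for `ℤ`-lattices `M ≤ M'` of cusp forms with `f ∈ M`, `[e_f M : ℤ f] ∣ [e_f M' : ℤ f]`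
  (`M ⧸ (ℤf + M ∩ f^⊥) ↪ M' ⧸ (ℤf + M' ∩ f^⊥)` + Lagrange).
* Over a Néron `f`-line datum `Δ` with `f ∈ Λ`: `Δ.neronCongruenceNumber ∣ lineIndex (alStableLattice N) D.f` (desc's `r_AL`) and
  `Δ.neronCongruenceNumber ∣ congruenceNumber D.f` (`r_f`, ARS); hence `v_p(r^𝒩) ≤ v_p(r_f)`.
* `padicValNat_neronCongruenceNumber_le_modularDegree`: `v_p(r^𝒩) ≤ v_p(deg φ)` (from PROP 29.AO, `…NeronFLineBookkeeping`), and
  with the PRINTED fact `modularDegree_dvd_congruenceNumber` (Agashe–Ribet–Stein 2012 Thm 2.1, statement-only) on a minimal-degree datum: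
  `v_p(deg φ) ≤ v_p(r_f)` — the sandwich.  Pure bookkeeping; BSD is not proved by this; Manin's conjecture is not proved by this.
-/

set_option autoImplicit false
set_option linter.dupNamespace false

namespace Summit.BirchSwinnertonDyer.BirchSwinnertonDyer.Theorems.ManinLocalTwoThree.NeronFLineBookkeeping

open scoped MatrixGroups ModularForm
open CongruenceSubgroup Literature.NumberTheory.EllipticCurves.ModularForms
open Summit.BirchSwinnertonDyer.Rank1Residual.ManinAdditive

section Monotone

variable {N : ℕ} [NeZero N]

/-- **Monotonicity of the `f`-line index**: `f ∈ M ≤ M'` ⟹ `lineIndex M f ∣ lineIndex M' f` (the natural map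
`M ⧸ (ℤf + M ∩ f^⊥) → M' ⧸ (ℤf + M' ∩ f^⊥)` is injective because `g − t f ∈ M` for `g ∈ M`). [folklore] -/
theorem lineIndex_dvd_of_le {M M' : Submodule ℤ (CuspForm (Gamma0 N) 2)} {f : CuspForm (Gamma0 N) 2}
    (hf : f ∈ M) (h : M ≤ M') : lineIndex M f ∣ lineIndex M' f := by
  obtain ⟨K', hK'⟩ : ∃ K' : Submodule ℤ M', K' =
      ((ℤ ∙ f) ⊔ (M' ⊓ (LinearMap.ker (peterssonProductₗ (Gamma0 N) 2 f)).restrictScalars ℤ)).comap M'.subtype :=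
    ⟨_, rfl⟩
  obtain ⟨K, hK⟩ : ∃ K : Submodule ℤ M, K =
      ((ℤ ∙ f) ⊔ (M ⊓ (LinearMap.ker (peterssonProductₗ (Gamma0 N) 2 f)).restrictScalars ℤ)).comap M.subtype :=
    ⟨_, rfl⟩
  have hker : LinearMap.ker (K'.mkQ ∘ₗ Submodule.inclusion h) = K := by
    ext g
    rw [LinearMap.mem_ker, LinearMap.comp_apply, Submodule.mkQ_apply, Submodule.Quotient.mk_eq_zero, hK', hK,
      Submodule.mem_comap, Submodule.mem_comap, Submodule.subtype_apply, Submodule.subtype_apply,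
      Submodule.coe_inclusion, Submodule.mem_sup, Submodule.mem_sup]
    constructor
    · rintro ⟨y, hy, z, hz, hyz⟩
      obtain ⟨t, rfl⟩ := Submodule.mem_span_singleton.mp hy
      refine ⟨t • f, Submodule.mem_span_singleton.mpr ⟨t, rfl⟩, z,
        Submodule.mem_inf.mpr ⟨?_, (Submodule.mem_inf.mp hz).2⟩, hyz⟩
      have hz' : z = (g : CuspForm (Gamma0 N) 2) - t • f := eq_sub_of_add_eq' hyz
      rw [hz']
      exact M.sub_mem g.2 (M.smul_mem t hf)
    · rintro ⟨y, hy, z, hz, hyz⟩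
      exact ⟨y, hy, z, Submodule.mem_inf.mpr ⟨h (Submodule.mem_inf.mp hz).1, (Submodule.mem_inf.mp hz).2⟩, hyz⟩
  have h1 : lineIndex M f = Nat.card (LinearMap.range (K'.mkQ ∘ₗ Submodule.inclusion h)) := by
    show Nat.card (M ⧸ _) = _
    rw [← hK, ← hker]
    exact Nat.card_congr (LinearMap.quotKerEquivRange _).toEquiv
  have h2 : lineIndex M' f = Nat.card (M' ⧸ K') := by
    show Nat.card (M' ⧸ _) = _
    rw [← hK']
  rw [h1, h2]
  exact ⟨Nat.card ((M' ⧸ K') ⧸ LinearMap.range (K'.mkQ ∘ₗ Submodule.inclusion h)),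
    Submodule.card_eq_card_quotient_mul_card _⟩

end Monotone

variable {N : ℕ} [NeZero N] {W : WeierstrassCurve ℚ} [W.IsElliptic] {D : ModularParametrizationData W N}
  (Δ : NeronFLineDatum W D)

/-- `r^𝒩 ∣ r_AL` (desc's AL-stable index) when `f ∈ Λ` (`Λ ≤ S^{AL}`, `Λ_le_alStableLattice`). [folklore] -/
theorem neronCongruenceNumber_dvd_lineIndex_alStableLattice (hf : D.f ∈ Δ.Λ) :
    Δ.neronCongruenceNumber ∣ lineIndex (alStableLattice N) D.f :=
  lineIndex_dvd_of_le hf Δ.Λ_le_alStableLattice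

/-- `r^𝒩 ∣ r_f` (the congruence number of ARS) when `f ∈ Λ` (`Λ ≤ S₂(Γ₀(N); ℤ)`). [folklore] -/
theorem neronCongruenceNumber_dvd_congruenceNumber (hf : D.f ∈ Δ.Λ) :
    Δ.neronCongruenceNumber ∣ congruenceNumber D.f := by
  rw [← lineIndex_integralCuspForms0]
  exact lineIndex_dvd_of_le hf Δ.Λ_le

/-- **Lower half of imc's sandwich: `v_p(r^𝒩) ≤ v_p(deg φ)`** when `f ∈ Λ` (PROP 29.AO: the difference is `v_p(c) + v_p(s) ≥ 0`).
[folklore] -/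
theorem padicValNat_neronCongruenceNumber_le_modularDegree (hf : D.f ∈ Δ.Λ) (p : ℕ) [Fact p.Prime] :
    padicValNat p Δ.neronCongruenceNumber ≤ padicValNat p D.modularDegree := by
  have h := padicVal_bookkeeping Δ hf p
  have h0 : 0 ≤ padicValInt p D.maninConstant := by positivity
  omega

/-- **imc's sandwich `v_p(r^𝒩) ≤ v_p(deg φ) ≤ v_p(r_f)`** for a MINIMAL-DEGREE datum with `f ∈ Λ`, the upper half from the PRINTED fact
`modularDegree_dvd_congruenceNumber` (Agashe–Ribet–Stein 2012 Thm 2.1, statement-only, taken as a hypothesis) and `r_f ≠ 0`.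
CONDITIONAL on that fact. [cite: AgasheRibetStein2012, Thm. 2.1] -/
theorem padicValNat_sandwich (hf : D.f ∈ Δ.Λ) (hARS : modularDegree_dvd_congruenceNumber)
    (hmin : ∀ (W' : WeierstrassCurve ℚ) [W'.IsElliptic] (D' : ModularParametrizationData W' N),
      D'.f = D.f → D.modularDegree ≤ D'.modularDegree)
    (hr : congruenceNumber D.f ≠ 0) (p : ℕ) [Fact p.Prime] :
    padicValNat p Δ.neronCongruenceNumber ≤ padicValNat p D.modularDegree ∧
      padicValNat p D.modularDegree ≤ padicValNat p (congruenceNumber D.f) :=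
  ⟨padicValNat_neronCongruenceNumber_le_modularDegree Δ hf p,
    (padicValNat_dvd_iff_le (p := p) hr).mp (dvd_trans (pow_padicValNat_dvd (p := p)) (hARS W N D hmin))⟩

end Summit.BirchSwinnertonDyer.BirchSwinnertonDyer.Theorems.ManinLocalTwoThree.NeronFLineBookkeeping
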